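import Summits.BirchSwinnertonDyer.Rank1Residual.X11b.Three.CornerShapeGamma
import Summits.BirchSwinnertonDyer.Rank1Residual.X11b.Three.CornerShapeGammaSerre
import Summits.BirchSwinnertonDyer.Rank1Residual.X11b.Three.CornerShapeII
import Summits.BirchSwinnertonDyer.Rank1Residual.X11b.Three.CornerShapeIstar
import Summits.BirchSwinnertonDyer.Rank1Residual.X11b.Three.CornerTamagawaThree
import Literature.NumberTheory.EllipticCurves.Serre1972.PotentiallyGoodInertiaOrderProofs
import HarnessLib

/-!
# Class X11b at `p = 3`, the non-surjective CORNER: the corner-shape theorems WITHOUT the Serre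
# hypothesis (team N8/O2 = cell `b2b-bsdres`, sub-targets S14 / S14♯ / S14♭ / S14♮, seat x11b3-p6;
# STAGE C of the A215 programme, lead rows R20-3 (3) / L9)

HONEST FRAMING (verbatim, cell `b2b-bsdres`, run/shared/lean/b2b/bsd-rank1-residual/): the goal of
the cell is to DELETE the COMBINATION-SHAPED residual classes of the Birch–Swinnerton-Dyer formula for
ALL analytic-rank `≤ 1` elliptic curves over `ℚ` — assembled STRICTLY from published theorems — so
that the rank-`≤ 1` remainder becomes exactly the CONSTRUCTION-SHAPED classes, which are TYPED, NOT
attempted. This is not "finishing BSD". Team N8/O2 (X11b at `3`: `3 ∥ N`, `r_an = 1`, `E[3]`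
irreducible; §I O2 OPEN, X11 ∧ r = 1 ∧ p = 3 CONSTRUCTION-SHAPED). Research route; nothing booked; NO
label changes. THEOREMS ONLY: no definition, no named fact, no `sorry`.

## What this file does

The five corner files `CornerShapeGamma` (S14), `CornerShapeGammaSerre` (S14, named-fact form),
`CornerShapeII` (S14♯), `CornerShapeIstar` (S14♭ capstone) and `CornerTamagawaThree` (S14♮) state
their Serre-dependent theorems CONDITIONALLY, either on the per-pair hypothesis

  `hF : ∀ v, 5 ≤ ℓ(v) → v(j) ≤ 1 → 12 / gcd(12, ord_v Δ_min) ∣ #ρ̄_{E,3}(Γ_ℚ)`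

(Serre's inertia order at the potentially good places `v ∣ ℓ ≥ 5`), or on the named fact
`hS : Literature.NumberTheory.EllipticCurves.Serre1972.inertiaOrder_dvd_card_range_galoisRepTorsion`
(Serre 1972 §5.6 as quoted by Martin–Watkins 2006 §3.1–§3.2; cell registry A215), from which
`serre_hF_three` derives `hF`. That named fact is now a THEOREM of the tree:
`Literature.NumberTheory.EllipticCurves.Serre1972.inertiaOrder_dvd_card_range_galoisRepTorsion_holds`
(`Serre1972/PotentiallyGoodInertiaOrderProofs.lean`, via Serre–Tate rigidity on `T_p E`). This
sibling file (the parents are NOT edited) re-issues every `hS` / `hF` consumer of the five parents as a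
PRIMED TWIN: binder list = the parent's, token for token, minus `hS` / `hF`; conclusion verbatim;
proof = the parent's named-fact form applied with `inertiaOrder_dvd_card_range_galoisRepTorsion_holds`
supplied BY NAME. Nine twins (one per distinct statement; an `hF` theorem and its `_of_serre` form
have the same twin):

* `serre_hF_three'` — the per-pair hypothesis `hF` at `p = 3` holds for every elliptic `W/ℚ`;
* `primesEquiv_eq_two_of_not_surj_of_kodairaSymbolAt_IV_or_IVstar'`,
  `shapeGamma_over_two_of_not_surj'`, `not_kodairaSymbolAt_IV_or_IVstar_of_not_surj_of_ne_two'`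
  (S14: on the corner `ClassX11b W 3 ∧ ¬ Surj W 3` every place of type `IV`/`IV*` lies over `2`);
* `primesEquiv_eq_two_of_not_surj_of_kodairaSymbolAt_II_or_IIstar'`,
  `not_kodairaSymbolAt_II_or_IIstar_of_not_surj_of_ne_two'`,
  `kodairaSymbolAt_eq_III_or_IIIstar_or_Istar_of_not_surj'` (S14♯: no `II`/`II*` away from `2`;
  additive places `v ∤ 2` are `III`, `III*` or `Iₙ*`);
* `kodairaSymbolAt_eq_III_or_IIIstar_or_Istar_dvd_of_not_surj'` (S14 ∧ S14♯ ∧ S14♭ capstone: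
  `III`, `III*`, or `Iₙ*` with `3 ∣ n`);
* `three_dvd_tamagawaProduct_iff_of_not_surj_of_serre'` (S14♮: on the corner `3 ∣ ∏ c_ℓ` iff a
  split multiplicative prime or a γ-carrier OVER `2`; primed on its `_of_serre` parent because the
  parent file's unprimed `three_dvd_tamagawaProduct_iff_of_not_surj` is a DIFFERENT, already
  unconditional statement — the `ShapeGamma` form).

WHAT CHANGED: ONE PUBLISHED input — A215 = Serre 1972 §5.6 as quoted by Martin–Watkins 2006 §3.2,
the inertia-order divisibility at the potentially good places `ℓ ≥ 5` — is now a TREE THEOREM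
(harvest-2 E104, p314706) and leaves the binder lists: S14 (on the corner `ClassX11b W 3 ∧ ¬ Surj W 3`
every place of type `IV`/`IV*` lies over `2`), the `II`/`II*` and `Iₙ*` shape statements and the
`3`-part of the Tamagawa product on the corner are now free of any named-fact binder. The parents'
sentences "CONDITIONAL on Serre 1972 §5.6" stay where they are as history; this sibling says what
changed.

HONEST VALUE: one cited input fewer on the corner anatomy — these nine statements are now
UNCONDITIONAL theorems of the tree. They remain THEOREMS ABOUT THE CORNER: no class statement,
nothing booked, no label / mark / count / tier moved; X11 ∧ r = 1 at p = 3 stays CONSTRUCTION-SHAPED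
/ O2 OPEN; the node `Three.HsiehDescentAt₃` + its FOUR antecedents and the OPEN-LEAF REGISTER
{(γ), (A′-53), [GZ86 III (3.1)], hCM, hrec} ∪ {hPT ⟹ hR, hexc, hK1} are untouched (A215 was a
corner-file PUB binder, never a register leaf); TRUE-OPEN 1 684 = 722 + 961 + 1 and corner 296
unchanged; the net named-fact debt −1 is the gate's booking on p314706, not this file's; the census
readings quoted in the parents stay EVIDENCE, never a Literature fact. Axioms: `propext`,
`Classical.choice`, `Quot.sound`.

## References

* [Serre1972] J.-P. Serre, *Propriétés galoisiennes des points d'ordre fini des courbes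
  elliptiques*, Invent. Math. 15 (1972) 259–331: §5.6 (p. 312); §2.4 Prop. 15.
* [MartinWatkins2006] P. Martin, M. Watkins, *Symmetric powers of elliptic curve L-functions*,
  ANTS VII, LNCS 4076 (2006) 377–392: §3.1–§3.2.
* [SilvermanATAEC1994] J. H. Silverman, *Advanced Topics in the Arithmetic of Elliptic Curves*,
  GTM 151: IV.9.4 Table 4.1; V.5 Thm. 5.3; V.6 Prop. 6.1.
* Tree: `Literature/NumberTheory/EllipticCurves/Serre1972/PotentiallyGoodInertiaOrder{,Proofs}.lean`;
  the five parents under `Summits/BirchSwinnertonDyer/Rank1Residual/X11b/Three/`.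
* Cell files: `cells/x11b3/OWNERS.md` R20-3 (3) (Stage C), lead `WAKE-TRIGGERS.md` L9 / ADDENDUM 3,
  `cells/x11b3/REFEREE.md` §41.4 (countersign test), `cells/x11b3/CORNER-CENSUS.md` §2.3′.
-/

noncomputable section

open scoped Classical NumberField

open WeierstrassCurve NumberField IsDedekindDomain Literature.NumberTheory.EllipticCurves
  Rat.HeightOneSpectrum
  Literature.NumberTheory.DiophantineGeometry
  Literature.NumberTheory.EllipticCurves.Rank1Residual

namespace Summit.BirchSwinnertonDyer.Rank1Residual.X11b.Three

section Shapes

variable (W : WeierstrassCurve ℚ) [W.IsElliptic]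

/-! ### S14 (`CornerShapeGamma` / `CornerShapeGammaSerre`) without the Serre hypothesis -/

/-- **The per-pair hypothesis `hF` of S14 at `p = 3` HOLDS** for every elliptic `W/ℚ`: at a finite
place `v` over `ℓ ≥ 5` with `v(j) ≤ 1`, `12 / gcd(12, ord_v Δ_min) ∣ #ρ̄_{E,3}(Γ_ℚ)`. Twin of
`serre_hF_three` with `hS` discharged by the tree theorem
`Serre1972.inertiaOrder_dvd_card_range_galoisRepTorsion_holds`.
[cite: Serre1972, §5.6 (p. 312)] [cite: MartinWatkins2006, §3.1 and §3.2] -/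
theorem serre_hF_three' [Fact (Nat.Prime 3)] :
    ∀ v : HeightOneSpectrum (𝓞 ℚ), 5 ≤ (primesEquiv v : ℕ) → v.valuation ℚ W.j ≤ 1 →
      12 / Nat.gcd 12 (W.ordMinimalDiscriminant v) ∣ Nat.card (galoisRepTorsion W (3 : ℕ)).range :=
  serre_hF_three W Serre1972.inertiaOrder_dvd_card_range_galoisRepTorsion_holds

/-- **S14, UNCONDITIONAL: on the corner of X11b@3 every place of Kodaira type `IV` or `IV*` lies
over `2`** (`ClassX11b W 3`, `¬ Surj W 3`). Twin of
`primesEquiv_eq_two_of_not_surj_of_kodairaSymbolAt_IV_or_IVstar` minus `hF` (= its `_of_serre` form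
minus `hS`), the Serre input supplied by `Serre1972.inertiaOrder_dvd_card_range_galoisRepTorsion_holds`.
[cite: MartinWatkins2006, §3.2] [cite: Serre1972, §5.6 (p. 312) and §2.4 Prop. 15]
[cite: SilvermanATAEC1994, IV.9.4 Steps 5 and 8, Table 4.1] -/
theorem primesEquiv_eq_two_of_not_surj_of_kodairaSymbolAt_IV_or_IVstar' [Fact (Nat.Prime 3)]
    (hX : ClassX11b W 3) (hns : ¬ Surj W 3) {v : HeightOneSpectrum (𝓞 ℚ)}
    (hk : W.kodairaSymbolAt v = .IV ∨ W.kodairaSymbolAt v = .IVstar) :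
    (primesEquiv v : ℕ) = 2 :=
  primesEquiv_eq_two_of_not_surj_of_kodairaSymbolAt_IV_or_IVstar_of_serre W
    Serre1972.inertiaOrder_dvd_card_range_galoisRepTorsion_holds hX hns hk

/-- **S14, (T2γ) form, UNCONDITIONAL: on the corner a (T2γ)@3 witness lies over `2`** — if
`ShapeGamma W` (a place of type `IV`/`IV*` with local Tamagawa number `3`) then that place lies over
`2`. Twin of `shapeGamma_over_two_of_not_surj` minus `hF` (= `…_of_serre` minus `hS`). The census
reading quoted in the parent (0/140 over `2` as well) stays EVIDENCE; nothing booked.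
[cite: MartinWatkins2006, §3.2] [cite: Serre1972, §5.6 (p. 312)] -/
theorem shapeGamma_over_two_of_not_surj' [Fact (Nat.Prime 3)]
    (hX : ClassX11b W 3) (hns : ¬ Surj W 3) (hγ : ShapeGamma W) :
    ∃ v : HeightOneSpectrum (𝓞 ℚ), (primesEquiv v : ℕ) = 2 ∧
      (W.kodairaSymbolAt v = .IV ∨ W.kodairaSymbolAt v = .IVstar) ∧ W.tamagawaNumberAt v = 3 :=
  shapeGamma_over_two_of_not_surj_of_serre W
    Serre1972.inertiaOrder_dvd_card_range_galoisRepTorsion_holds hX hns hγ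

/-- **S14, binder-list form, UNCONDITIONAL: on the corner there is NO place of type `IV`/`IV*` over
any `ℓ ≠ 2`.** Twin of `not_kodairaSymbolAt_IV_or_IVstar_of_not_surj_of_ne_two` minus `hF`
(= `…_of_serre` minus `hS`). [cite: MartinWatkins2006, §3.2] [cite: Serre1972, §5.6 (p. 312)] -/
theorem not_kodairaSymbolAt_IV_or_IVstar_of_not_surj_of_ne_two' [Fact (Nat.Prime 3)]
    (hX : ClassX11b W 3) (hns : ¬ Surj W 3) {v : HeightOneSpectrum (𝓞 ℚ)}
    (hv : (primesEquiv v : ℕ) ≠ 2) :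
    ¬ (W.kodairaSymbolAt v = .IV ∨ W.kodairaSymbolAt v = .IVstar) :=
  not_kodairaSymbolAt_IV_or_IVstar_of_not_surj_of_ne_two_of_serre W
    Serre1972.inertiaOrder_dvd_card_range_galoisRepTorsion_holds hX hns hv

/-! ### S14♯ (`CornerShapeII`) without the Serre hypothesis -/

/-- **S14♯, UNCONDITIONAL: on the corner of X11b@3 every place of Kodaira type `II` or `II*` lies
over `2`** (`ClassX11b W 3`, `¬ Surj W 3`). Twin of
`primesEquiv_eq_two_of_not_surj_of_kodairaSymbolAt_II_or_IIstar` minus `hF` (= `…_of_serre` minus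
`hS`). [cite: MartinWatkins2006, §3.2] [cite: Serre1972, §5.6 (p. 312) and §2.4 Prop. 15]
[cite: SilvermanATAEC1994, IV.9.4 Steps 3 and 10, Table 4.1] -/
theorem primesEquiv_eq_two_of_not_surj_of_kodairaSymbolAt_II_or_IIstar' [Fact (Nat.Prime 3)]
    (hX : ClassX11b W 3) (hns : ¬ Surj W 3) {v : HeightOneSpectrum (𝓞 ℚ)}
    (hk : W.kodairaSymbolAt v = .II ∨ W.kodairaSymbolAt v = .IIstar) :
    (primesEquiv v : ℕ) = 2 :=
  primesEquiv_eq_two_of_not_surj_of_kodairaSymbolAt_II_or_IIstar_of_serre W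
    Serre1972.inertiaOrder_dvd_card_range_galoisRepTorsion_holds hX hns hk

/-- **S14♯, binder-list form, UNCONDITIONAL: on the corner there is NO place of type `II`/`II*`
over any `ℓ ≠ 2`.** Twin of `not_kodairaSymbolAt_II_or_IIstar_of_not_surj_of_ne_two` minus `hF`
(= `…_of_serre` minus `hS`). [cite: MartinWatkins2006, §3.2] [cite: Serre1972, §5.6 (p. 312)] -/
theorem not_kodairaSymbolAt_II_or_IIstar_of_not_surj_of_ne_two' [Fact (Nat.Prime 3)]
    (hX : ClassX11b W 3) (hns : ¬ Surj W 3) {v : HeightOneSpectrum (𝓞 ℚ)}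
    (hv : (primesEquiv v : ℕ) ≠ 2) :
    ¬ (W.kodairaSymbolAt v = .II ∨ W.kodairaSymbolAt v = .IIstar) :=
  not_kodairaSymbolAt_II_or_IIstar_of_not_surj_of_ne_two_of_serre W
    Serre1972.inertiaOrder_dvd_card_range_galoisRepTorsion_holds hX hns hv

/-- **S14 ∧ S14♯, THE ADDITIVE ANATOMY OF THE CORNER, UNCONDITIONAL: at an ADDITIVE place `v ∤ 2`
of a pair with `ClassX11b W 3 ∧ ¬ Surj W 3`, the Kodaira type is `III`, `III*` or `Iₙ*`**
(`n ≥ 0`). Twin of `kodairaSymbolAt_eq_III_or_IIIstar_or_Istar_of_not_surj` minus `hF`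
(= `…_of_serre` minus `hS`). Kernel form of `cells/x11b3/CORNER-CENSUS.md` §2.3′ (the census
reading there stays EVIDENCE); nothing booked.
[cite: MartinWatkins2006, §3.2] [cite: Serre1972, §5.6 (p. 312)] [cite: SilvermanATAEC1994, IV.9.4 Table 4.1] -/
theorem kodairaSymbolAt_eq_III_or_IIIstar_or_Istar_of_not_surj' [Fact (Nat.Prime 3)]
    (hX : ClassX11b W 3) (hns : ¬ Surj W 3) {v : HeightOneSpectrum (𝓞 ℚ)}
    (hv : (primesEquiv v : ℕ) ≠ 2) (hadd : W.HasAdditiveReductionAt v) :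
    W.kodairaSymbolAt v = .III ∨ W.kodairaSymbolAt v = .IIIstar ∨
      ∃ n : ℕ, W.kodairaSymbolAt v = .Istar n :=
  kodairaSymbolAt_eq_III_or_IIIstar_or_Istar_of_not_surj_of_serre W
    Serre1972.inertiaOrder_dvd_card_range_galoisRepTorsion_holds hX hns hv hadd

/-! ### S14 ∧ S14♯ ∧ S14♭ capstone (`CornerShapeIstar`) without the Serre hypothesis -/

/-- **THE ADDITIVE ANATOMY OF THE CORNER AT ODD PLACES, UNCONDITIONAL**: on the non-surjective
corner of X11b@3, at an ADDITIVE place `v ∤ 2` the Kodaira type is `III`, `III*`, or `Iₙ*` WITH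
`3 ∣ n`. Twin of `kodairaSymbolAt_eq_III_or_IIIstar_or_Istar_dvd_of_not_surj` minus `hF`
(= `…_of_serre` minus `hS`). Kernel form of `cells/x11b3/CORNER-CENSUS.md` §2.3′ in full (odd `ℓ`:
`III` / `III*` / `I₀*` / `I₃*` / `I₆*` — EVIDENCE); nothing booked; no TRUE-OPEN cell touched.
[cite: MartinWatkins2006, §3.2] [cite: Serre1972, §5.6 (p. 312) and §2.4 Prop. 15]
[cite: SilvermanATAEC1994, IV.9.4 Table 4.1; V.5 Thm. 5.3] -/
theorem kodairaSymbolAt_eq_III_or_IIIstar_or_Istar_dvd_of_not_surj' [Fact (Nat.Prime 3)]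
    (hX : ClassX11b W 3) (hns : ¬ Surj W 3) {v : HeightOneSpectrum (𝓞 ℚ)}
    (hv : (primesEquiv v : ℕ) ≠ 2) (hadd : W.HasAdditiveReductionAt v) :
    W.kodairaSymbolAt v = .III ∨ W.kodairaSymbolAt v = .IIIstar ∨
      ∃ n : ℕ, 3 ∣ n ∧ W.kodairaSymbolAt v = .Istar n :=
  kodairaSymbolAt_eq_III_or_IIIstar_or_Istar_dvd_of_not_surj_of_serre W
    Serre1972.inertiaOrder_dvd_card_range_galoisRepTorsion_holds hX hns hv hadd

end Shapes

section Tamagawa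

variable (W : WeierstrassCurve ℚ) [W.IsElliptic] [W.IsGloballyMinimal]

/-! ### S14♮ (`CornerTamagawaThree`) without the Serre hypothesis -/

/-- **The `3`-part of the Tamagawa product on the corner, UNCONDITIONAL**: for a globally minimal
`W/ℚ` with `ClassX11b W 3 ∧ ¬ Surj W 3`, `3 ∣ ∏ c_ℓ(E)` iff `E` has a split multiplicative prime or
a place OVER `2` of type `IV`/`IV*` with `c₂ = 3`. Twin of
`three_dvd_tamagawaProduct_iff_of_not_surj_of_serre` minus `hS` (primed on the `_of_serre` name: the
parent's unprimed `three_dvd_tamagawaProduct_iff_of_not_surj` is the different `ShapeGamma` form).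
[cite: MartinWatkins2006, §3.2] [cite: Serre1972, §5.6 (p. 312)]
[cite: SilvermanATAEC1994, IV.9.4 Table 4.1; V.6 Prop. 6.1] -/
theorem three_dvd_tamagawaProduct_iff_of_not_surj_of_serre' [Fact (Nat.Prime 3)]
    (hX : ClassX11b W 3) (hns : ¬ Surj W 3) :
    3 ∣ W.tamagawaProduct ↔
      (∃ ℓ : ℕ, ∃ _ : Fact ℓ.Prime, W.HasSplitMultiplicativeReductionAtPrime ℓ) ∨
        ∃ v : HeightOneSpectrum (𝓞 ℚ), (primesEquiv v : ℕ) = 2 ∧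
          (W.kodairaSymbolAt v = .IV ∨ W.kodairaSymbolAt v = .IVstar) ∧ W.tamagawaNumberAt v = 3 :=
  three_dvd_tamagawaProduct_iff_of_not_surj_of_serre W
    Serre1972.inertiaOrder_dvd_card_range_galoisRepTorsion_holds hX hns

end Tamagawa

end Summit.BirchSwinnertonDyer.Rank1Residual.X11b.Three

end
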